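import Literature.NumberTheory.Automorphic.AdicCompletionDegreeOnePlaceProofs
import Literature.NumberTheory.GaloisRepresentations.PadicAlgebraOfLocalField
import Literature.NumberTheory.NumberFields.PadicLocalDegreesTower
import Mathlib.NumberTheory.Padics.HeightOneSpectrum
import HarnessLib

/-!
# At a place of degree one over `p`, the canonical `ℚ_p`-algebra structure `ℚ_p → F_v` is an
# isomorphism; labels `F_v →ₐ[ℚ_p] E` are unique

Topic `Literature/NumberTheory/GaloisRepresentations` (sibling proof file of `PadicAlgebraOfLocalField`,
theorems only).  For a number field `F`, a rational prime `p` and a finite place `v ∣ p` of `F`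
with `e(v|p) = f(v|p) = 1` (ramification index and residue degree over `𝓞 ℚ`), the canonical
`ℚ_p`-algebra structure on the completion `F_v` (`LocalField.adicCompletionPadicAlgebra`: THE unique
continuous ring homomorphism `ℚ_p → F_v`, the structure pinned by the summit's Fontaine datum,
`fontainePst_algebra_eq_padicAlgebra`) is BIJECTIVE (`bijective_algebraMap_adicCompletionPadicAlgebra`):
the local degree formula `[F_v : ℚ_p] = e f` in degree one.  Consequently every `ℚ_p`-algebra
`E` receives at most one `ℚ_p`-algebra homomorphism `F_v →ₐ[ℚ_p] E`
(`subsingleton_algHom_adicCompletion_of_degree_one`): at a place of degree one there is ONE label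
`τ : F_v → ℚ̄_p`, so `τ`-labelled invariants (Hodge–Tate weights) at `v` do not depend on the label.

Proof: `F_v` is the image of `ℚ_{v₀}` (`v₀ = v ∩ 𝓞 ℚ`) under the local base-change map, which is
onto at a place of degree one (`surjective_adicCompletionOfLiesOver`, file
`AdicCompletionDegreeOnePlaceProofs`); `ℚ_{v₀} ≃ ℚ_p` continuously (Mathlib
`Rat.HeightOneSpectrum.adicCompletion.padicEquiv`, with `primesEquiv v₀ = p` because `p ∈ v₀`);
the composite `ℚ_p → ℚ_{v₀} → F_v` is a continuous ring homomorphism, hence THE canonical one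
(`LocalField.eq_algebraMap_adicCompletionPadicAlgebra`).

Also proved, for the consumers' hypothesis "`p` split in a quadratic field": in a quadratic number
field, two distinct places above `p` are all the places above `p` and each has `e = f = 1`
(`ramificationIdx_eq_one_and_inertiaDeg_eq_one_of_ne`, `eq_or_eq_of_ne_of_mem`), from the
fundamental identity `∑ e f = 2`.

## References

* J. Neukirch, *Algebraic Number Theory* (1999), Ch. II (8.?) / Ch. I (8.2): local degrees and the
  fundamental identity. [NeukirchANT1999]
* J.-P. Serre, *Local Fields* (1979), Ch. II §5 (the canonical `ℚ_p ⊆ K`). [SerreLocalFields1979]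
-/

noncomputable section

open IsDedekindDomain NumberField

namespace Literature.NumberTheory.GaloisRepresentations

namespace LocalField

/-! ### The place of `ℚ` below `v` is `(p)` -/

section RatPlace

/-- A height-one prime of `𝓞 ℚ` containing the rational prime `p` has `natGenerator = p`
(Mathlib `Rat.HeightOneSpectrum.natGenerator`), i.e. corresponds to `p` under
`Rat.HeightOneSpectrum.primesEquiv`. [folklore] -/
theorem natGenerator_eq_of_natCast_mem (p : ℕ) [hp : Fact p.Prime]
    (v₀ : HeightOneSpectrum (𝓞 ℚ)) (hv₀ : ((p : ℕ) : 𝓞 ℚ) ∈ v₀.asIdeal) :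
    Rat.HeightOneSpectrum.natGenerator v₀ = p := by
  have hdvd : Rat.HeightOneSpectrum.natGenerator v₀ ∣ p := by
    rw [Rat.HeightOneSpectrum.natGenerator_dvd_iff]
    have : ((p : ℕ) : ℤ) = Rat.IsIntegralClosure.intEquiv (𝓞 ℚ) ((p : ℕ) : 𝓞 ℚ) := by
      rw [map_natCast]
    rw [this]
    exact Ideal.mem_map_of_mem _ hv₀
  have hprime := Rat.HeightOneSpectrum.prime_natGenerator v₀
  exact (Nat.prime_dvd_prime_iff_eq hprime hp.out).1 hdvd

/-- The same, for `primesEquiv`. [folklore] -/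
theorem primesEquiv_eq_of_natCast_mem (p : ℕ) [Fact p.Prime]
    (v₀ : HeightOneSpectrum (𝓞 ℚ)) (hv₀ : ((p : ℕ) : 𝓞 ℚ) ∈ v₀.asIdeal) :
    ((Rat.HeightOneSpectrum.primesEquiv v₀ : Nat.Primes) : ℕ) = p :=
  natGenerator_eq_of_natCast_mem p v₀ hv₀

end RatPlace

/-! ### Degree one: `ℚ_p → F_v` is bijective -/

section DegreeOne

variable {F : Type} [Field F] [NumberField F] (p : ℕ) [Fact p.Prime]
  (v : HeightOneSpectrum (𝓞 F))

/-- **`[F_v : ℚ_p] = 1` at a place of degree one.**  If `e(v|p) = f(v|p) = 1` (over `𝓞 ℚ`), the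
canonical `ℚ_p`-algebra map `ℚ_p → F_v` (`adicCompletionPadicAlgebra`) is bijective. [folklore] -/
theorem bijective_algebraMap_adicCompletionPadicAlgebra (hv : ((p : ℕ) : 𝓞 F) ∈ v.asIdeal)
    (he : v.asIdeal.ramificationIdx (𝓞 ℚ) = 1) (hf : v.asIdeal.inertiaDeg (𝓞 ℚ) = 1) :
    letI := adicCompletionPadicAlgebra v p hv
    Function.Bijective (algebraMap ℚ_[p] (v.adicCompletion F)) := by
  -- the place of `ℚ` below `v`
  let v₀ : HeightOneSpectrum (𝓞 ℚ) := v.under (𝓞 ℚ)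
  haveI : v.asIdeal.LiesOver v₀.asIdeal := ⟨rfl⟩
  have hv₀ : ((p : ℕ) : 𝓞 ℚ) ∈ v₀.asIdeal := by
    change ((p : ℕ) : 𝓞 ℚ) ∈ v.asIdeal.comap (algebraMap (𝓞 ℚ) (𝓞 F))
    rw [Ideal.mem_comap, map_natCast]
    exact hv
  -- `primesEquiv v₀ = p`, so `ℚ_{v₀} ≃ ℚ_p`
  obtain rfl : ((Rat.HeightOneSpectrum.primesEquiv v₀ : Nat.Primes) : ℕ) = p :=
    primesEquiv_eq_of_natCast_mem p v₀ hv₀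
  let e := Rat.HeightOneSpectrum.adicCompletion.padicEquiv v₀
  -- the local base change `ℚ_{v₀} → F_v`, onto in degree one
  let ι := Literature.NumberTheory.Automorphic.adicCompletionOfLiesOver ℚ F v₀ v
  have hι : Function.Bijective ι :=
    ⟨ι.injective, Literature.NumberTheory.Automorphic.surjective_adicCompletionOfLiesOver ℚ F v₀ v he hf⟩
  -- the composite `ℚ_p → ℚ_{v₀} → F_v` is continuous, hence the canonical map
  let φ : ℚ_[(Rat.HeightOneSpectrum.primesEquiv v₀ : ℕ)] →+* v.adicCompletion F :=
    ι.comp (e.symm : _ ≃A[ℚ] _).toRingEquiv.toRingHom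
  have hφc : Continuous φ :=
    (Literature.NumberTheory.Automorphic.continuous_adicCompletionOfLiesOver ℚ F v₀ v).comp
      e.symm.continuous
  have hφ : φ = (letI := adicCompletionPadicAlgebra v _ hv;
      algebraMap ℚ_[(Rat.HeightOneSpectrum.primesEquiv v₀ : ℕ)] (v.adicCompletion F)) :=
    eq_algebraMap_adicCompletionPadicAlgebra v _ hv φ hφc
  have hφb : Function.Bijective φ := hι.comp e.symm.bijective
  rw [hφ] at hφb
  exact hφb

/-- **One label at a place of degree one**: for `e(v|p) = f(v|p) = 1` and any `ℚ_p`-algebra `E`,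
there is at most one `ℚ_p`-algebra homomorphism `F_v →ₐ[ℚ_p] E` (for the canonical
`ℚ_p`-structure on `F_v`). [folklore] -/
theorem subsingleton_algHom_adicCompletion_of_degree_one (hv : ((p : ℕ) : 𝓞 F) ∈ v.asIdeal)
    (he : v.asIdeal.ramificationIdx (𝓞 ℚ) = 1) (hf : v.asIdeal.inertiaDeg (𝓞 ℚ) = 1)
    (E : Type*) [Semiring E] [Algebra ℚ_[p] E] :
    letI := adicCompletionPadicAlgebra v p hv
    Subsingleton (v.adicCompletion F →ₐ[ℚ_[p]] E) := by
  letI := adicCompletionPadicAlgebra v p hv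
  refine ⟨fun τ₁ τ₂ => AlgHom.ext fun x => ?_⟩
  obtain ⟨a, rfl⟩ := (bijective_algebraMap_adicCompletionPadicAlgebra p v hv he hf).2 x
  rw [AlgHom.commutes, AlgHom.commutes]

/-- In particular any two labels agree: `τ₁ = τ₂`. [folklore] -/
theorem algHom_adicCompletion_eq_of_degree_one (hv : ((p : ℕ) : 𝓞 F) ∈ v.asIdeal)
    (he : v.asIdeal.ramificationIdx (𝓞 ℚ) = 1) (hf : v.asIdeal.inertiaDeg (𝓞 ℚ) = 1)
    {E : Type*} [Semiring E] [Algebra ℚ_[p] E]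
    (τ₁ τ₂ : letI := adicCompletionPadicAlgebra v p hv; v.adicCompletion F →ₐ[ℚ_[p]] E) :
    τ₁ = τ₂ :=
  (subsingleton_algHom_adicCompletion_of_degree_one p v hv he hf E).elim τ₁ τ₂

end DegreeOne

/-! ### Split primes in a quadratic field: `e = f = 1` and exactly two places -/

section Quadratic

variable {F : Type} [Field F] [NumberField F] (p : ℕ) [Fact p.Prime]

/-- Two height-one primes of `𝓞 ℚ` containing the same rational prime `p` are equal. [folklore] -/
theorem heightOneSpectrum_rat_eq_of_natCast_mem (v₀ w₀ : HeightOneSpectrum (𝓞 ℚ))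
    (hv₀ : ((p : ℕ) : 𝓞 ℚ) ∈ v₀.asIdeal) (hw₀ : ((p : ℕ) : 𝓞 ℚ) ∈ w₀.asIdeal) : v₀ = w₀ := by
  apply Rat.HeightOneSpectrum.primesEquiv.injective
  apply Subtype.ext
  rw [primesEquiv_eq_of_natCast_mem p v₀ hv₀, primesEquiv_eq_of_natCast_mem p w₀ hw₀]

omit [Fact p.Prime] in
/-- The place below `v ∣ p`: `p ∈ v ∩ 𝓞 ℚ`. [folklore] -/
theorem natCast_mem_under (v : HeightOneSpectrum (𝓞 F)) (hv : ((p : ℕ) : 𝓞 F) ∈ v.asIdeal) :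
    ((p : ℕ) : 𝓞 ℚ) ∈ (v.under (𝓞 ℚ)).asIdeal := by
  change ((p : ℕ) : 𝓞 ℚ) ∈ v.asIdeal.comap (algebraMap (𝓞 ℚ) (𝓞 F))
  rw [Ideal.mem_comap, map_natCast]
  exact hv

/-- **`p` split in a quadratic field: local degrees.**  Let `F/ℚ` be quadratic and `v ≠ w` two
places of `F` above the rational prime `p`.  Then `e(v|p) = f(v|p) = 1`, and every place above `p`
is `v` or `w` — from the fundamental identity `∑_{u ∣ p} e(u|p) f(u|p) = [F : ℚ] = 2`
(`Literature.NumberTheory.NumberFields.sum_ramificationIdx_mul_inertiaDeg_eq_finrank_of_isMaximal`).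
[folklore] -/
theorem ramificationIdx_eq_one_and_inertiaDeg_eq_one_of_ne [Algebra.IsQuadraticExtension ℚ F]
    (v w : HeightOneSpectrum (𝓞 F)) (hvw : v ≠ w) (hv : ((p : ℕ) : 𝓞 F) ∈ v.asIdeal)
    (hw : ((p : ℕ) : 𝓞 F) ∈ w.asIdeal) :
    (v.asIdeal.ramificationIdx (𝓞 ℚ) = 1 ∧ v.asIdeal.inertiaDeg (𝓞 ℚ) = 1) ∧
      ∀ u : HeightOneSpectrum (𝓞 F), ((p : ℕ) : 𝓞 F) ∈ u.asIdeal → u = v ∨ u = w := by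
  classical
  -- the common place `P = (p)` of `ℚ` below `v` and `w`
  set P : Ideal (𝓞 ℚ) := (v.under (𝓞 ℚ)).asIdeal with hP
  haveI hPmax : P.IsMaximal := (v.under (𝓞 ℚ)).isMaximal
  have hunder : ∀ u : HeightOneSpectrum (𝓞 F), ((p : ℕ) : 𝓞 F) ∈ u.asIdeal →
      u.under (𝓞 ℚ) = v.under (𝓞 ℚ) := fun u hu =>
    heightOneSpectrum_rat_eq_of_natCast_mem p _ _ (natCast_mem_under p u hu) (natCast_mem_under p v hv)
  -- every place `u ∣ p` gives an element of `P.primesOver (𝓞 F)`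
  have hmemPO : ∀ u : HeightOneSpectrum (𝓞 F), ((p : ℕ) : 𝓞 F) ∈ u.asIdeal →
      u.asIdeal ∈ P.primesOver (𝓞 F) := fun u hu =>
    ⟨u.isPrime, ⟨by rw [hP, ← hunder u hu]; rfl⟩⟩
  let ι : {u : HeightOneSpectrum (𝓞 F) // ((p : ℕ) : 𝓞 F) ∈ u.asIdeal} → P.primesOver (𝓞 F) :=
    fun u => ⟨u.1.asIdeal, hmemPO u.1 u.2⟩
  have hι : Function.Injective ι := by
    intro u₁ u₂ h
    apply Subtype.ext
    apply HeightOneSpectrum.ext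
    exact congrArg Subtype.val h
  -- the terms of the fundamental identity are `≥ 1`
  let t : P.primesOver (𝓞 F) → ℕ := fun 𝔓 =>
    (𝔓 : Ideal (𝓞 F)).ramificationIdx (𝓞 ℚ) * (𝔓 : Ideal (𝓞 F)).inertiaDeg (𝓞 ℚ)
  have hsum : ∑ 𝔓, t 𝔓 = 2 := by
    rw [Literature.NumberTheory.NumberFields.sum_ramificationIdx_mul_inertiaDeg_eq_finrank_of_isMaximal
      ℚ F P, Algebra.IsQuadraticExtension.finrank_eq_two]
  have hpos : ∀ 𝔓 : P.primesOver (𝓞 F), 1 ≤ t 𝔓 := fun 𝔓 => by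
    haveI : (𝔓 : Ideal (𝓞 F)).IsPrime := 𝔓.2.1
    exact Nat.one_le_iff_ne_zero.2 (Nat.mul_ne_zero
      (Ideal.ramificationIdx_pos (𝔓 : Ideal (𝓞 F)) (𝓞 ℚ)).ne'
      (Ideal.inertiaDeg_pos (𝔓 : Ideal (𝓞 F)) (𝓞 ℚ)).ne')
  -- the two distinct elements `v`, `w`
  set xv : P.primesOver (𝓞 F) := ι ⟨v, hv⟩ with hxv
  set xw : P.primesOver (𝓞 F) := ι ⟨w, hw⟩ with hxw
  have hne : xv ≠ xw := fun h => hvw (congrArg Subtype.val (hι h))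
  have hpair : t xv + t xw ≤ 2 := by
    rw [← hsum, ← Finset.sum_pair hne]
    exact Finset.sum_le_sum_of_subset (Finset.subset_univ _)
  have htv : t xv = 1 := by have := hpos xv; have := hpos xw; omega
  have htw : t xw = 1 := by have := hpos xv; have := hpos xw; omega
  refine ⟨?_, fun u hu => ?_⟩
  · exact ⟨Nat.eq_one_of_mul_eq_one_right htv, Nat.eq_one_of_mul_eq_one_left htv⟩
  · by_contra hnot
    push Not at hnot
    set xu : P.primesOver (𝓞 F) := ι ⟨u, hu⟩ with hxu
    have hne1 : xu ≠ xv := fun h => hnot.1 (congrArg Subtype.val (hι h))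
    have hne2 : xu ≠ xw := fun h => hnot.2 (congrArg Subtype.val (hι h))
    have htriple : t xu + (t xv + t xw) ≤ 2 := by
      rw [← hsum, ← Finset.sum_pair hne, ← Finset.sum_insert (by
        simp only [Finset.mem_insert, Finset.mem_singleton, not_or]; exact ⟨hne1, hne2⟩)]
      exact Finset.sum_le_sum_of_subset (Finset.subset_univ _)
    have := hpos xu
    omega

/-- **At a place of a quadratic field above a split prime there is one label.**  For `F/ℚ`
quadratic, `v ≠ w` above `p` and any `ℚ_p`-algebra `E`, `ℚ_p`-algebra homomorphisms
`F_v →ₐ[ℚ_p] E` (canonical `ℚ_p`-structure) are unique. [folklore] -/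
theorem subsingleton_algHom_adicCompletion_of_split [Algebra.IsQuadraticExtension ℚ F]
    (v w : HeightOneSpectrum (𝓞 F)) (hvw : v ≠ w) (hv : ((p : ℕ) : 𝓞 F) ∈ v.asIdeal)
    (hw : ((p : ℕ) : 𝓞 F) ∈ w.asIdeal) (E : Type*) [Semiring E] [Algebra ℚ_[p] E] :
    letI := adicCompletionPadicAlgebra v p hv
    Subsingleton (v.adicCompletion F →ₐ[ℚ_[p]] E) :=
  have h := (ramificationIdx_eq_one_and_inertiaDeg_eq_one_of_ne p v w hvw hv hw).1
  subsingleton_algHom_adicCompletion_of_degree_one p v hv h.1 h.2 E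

/-- And the canonical `ℚ_p → F_v` is bijective there (`[F_v : ℚ_p] = 1`). [folklore] -/
theorem bijective_algebraMap_adicCompletionPadicAlgebra_of_split [Algebra.IsQuadraticExtension ℚ F]
    (v w : HeightOneSpectrum (𝓞 F)) (hvw : v ≠ w) (hv : ((p : ℕ) : 𝓞 F) ∈ v.asIdeal)
    (hw : ((p : ℕ) : 𝓞 F) ∈ w.asIdeal) :
    letI := adicCompletionPadicAlgebra v p hv
    Function.Bijective (algebraMap ℚ_[p] (v.adicCompletion F)) :=
  have h := (ramificationIdx_eq_one_and_inertiaDeg_eq_one_of_ne p v w hvw hv hw).1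
  bijective_algebraMap_adicCompletionPadicAlgebra p v hv h.1 h.2

end Quadratic

end LocalField

end Literature.NumberTheory.GaloisRepresentations

end
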